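import Literature.AlgebraicGeometry.Resolution.DifferentialOperators
import Literature.AlgebraicGeometry.Resolution.HasseSchmidtDerivatives
import Mathlib.RingTheory.Derivation.Basic
import Mathlib.Data.Finsupp.Weight
import Mathlib.Data.Finsupp.Antidiagonal
import Mathlib.Algebra.Order.Antidiag.Finsupp
import HarnessLib

/-!
# Differential operators in the presence of a Hasse–Schmidt coordinate system (EGA IV₄ 16.11.2, abstract form)

Let `B` be a commutative `k`-algebra and `x = (x_i)_{i ∈ ι}` a finite family of elements of `B` such that

* (UNR) every `k`-derivation `δ : B → B` with `δ(x_i) = 0` for all `i` vanishes (`B` is "unramified over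
  `k[x]`", e.g. `x` an étale / regular coordinate system), and
* (HS) `B` carries a *truncated Hasse–Schmidt system* of level `n` along `x`: `k`-linear maps
  `Δ_q : B → B`, `q ∈ ℕ^ι`, `|q| ≤ n`, with `Δ_0 = id`, the higher Leibniz rule
  `Δ_q(fg) = Σ_{q₁+q₂=q} Δ_{q₁}(f) Δ_{q₂}(g)` and the values `Δ_β(x^β) = 1`, `Δ_q(x^β) = 0` for `q ≰ β`
  (as for the divided partial derivatives `∂^{(q)} x^β = (β over q) x^{β−q}`).

Then (Grothendieck's differential operators `IsDiffOpLE` / `diffOp` / `diffIdeal` of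
`DifferentialOperators.lean`, EGA IV₄ 16.8):

* `isDiffOpLE_zero_of_commMul_coord_eq_zero` — under (UNR) an operator of finite order commuting with
  all `x_i` has order `≤ 0`;
* `eq_zero_of_isDiffOpLE_of_apply_coordMonomial_eq_zero` — under (UNR) an operator of order `≤ m` killing the
  monomials `x^β`, `|β| ≤ m`, is zero;
* `isDiffOpLE_of_hasseSystem` — each `Δ_q` is a differential operator of order `≤ |q|`;
* `mem_span_hasseSystem_of_isDiffOpLE` — **every differential operator of order `≤ n` is a `B`-linear
  combination of the `Δ_q`, `|q| ≤ n`** (EGA IV₄ Thm. 16.11.2, spanning half, proved by commutator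
  induction — no principal parts);
* `diffIdeal_mul_le_of_hasseSystem` — consequently the **Leibniz inclusion**
  `Diff^{≤ n}(I·J) ⊆ Σ_{i ≤ n} Diff^{≤ i}(I) · Diff^{≤ n−i}(J)`.

The polynomial ring `k[x_σ]` with its Hasse–Schmidt derivatives (`HasseSchmidtDerivatives.lean`,
`HasseSchmidtDiffEqDiffOp.lean`) is the model case; smooth algebras carry such systems locally (étale
coordinates), which is how these lemmas are used (Hironaka 2017 ms., Lem. 4.2; campaign res-hironaka, lane
HIRONAKA-L, C-01 of D/res-D-lit-1/FACT-INDEX.md). Nothing here is specific to that manuscript.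

## References

* [EGAIV4] A. Grothendieck, J. Dieudonné, ÉGA IV₄, Publ. Math. IHÉS 32 (1967), Déf. 16.8.1, Prop. 16.8.8,
  Thm. 16.11.2 (Diff^m has the basis D_q, |q| ≤ m, when Ω¹ has the basis dz_i), Cor. 16.11.3.
* [VillamayorU2008ReesDiff] O. Villamayor U., *Rees algebras on smooth schemes: integral closure and higher
  differential operators*, Rev. Mat. Iberoam. 24 (2008), §2.6, §3 (Leibniz for the Δ^α; Diff-algebras).
-/

open scoped BigOperators

namespace Literature.AlgebraicGeometry.Resolution

section CoordSpan

variable (k : Type*) {B : Type*} [CommRing k] [CommRing B] [Algebra k B]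
variable {ι : Type*}

/-! ### Commutator plumbing -/

/-- Commutators with two multiplications commute: `[[D, a], b] = [[D, b], a]`.
[cite: EGAIV4, Prop. 16.8.8 (proof, (16.8.8.2): the D_{a,b} are symmetric)] -/
theorem commMul_comm (D : B →ₗ[k] B) (a b : B) :
    commMul k (commMul k D a) b = commMul k (commMul k D b) a := by
  ext t
  simp only [commMul_apply, mul_sub]
  rw [mul_left_comm b a t]
  ring

/-- `x_i · x^β = x^{e_i + β}` for a finite family `x` (plumbing). [cite: EGAIV4, Thm. 16.11.2 (notation z^q)] -/
theorem coord_mul_prod_pow [Fintype ι] [DecidableEq ι] (x : ι → B) (i : ι) (β : ι →₀ ℕ) :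
    x i * ∏ j, x j ^ β j = ∏ j, x j ^ (Finsupp.single i 1 + β : ι →₀ ℕ) j := by
  have h : ∀ j, x j ^ (Finsupp.single i 1 + β : ι →₀ ℕ) j = (if j = i then x j else 1) * x j ^ β j := by
    intro j
    rw [Finsupp.add_apply, pow_add, Finsupp.single_apply]
    by_cases hj : i = j
    · subst hj; simp
    · simp [hj, Ne.symm hj]
  simp_rw [h]
  rw [Finset.prod_mul_distrib, Finset.prod_ite_eq' Finset.univ i, if_pos (Finset.mem_univ i)]

/-! ### (UNR) ⇒ operators commuting with the coordinates have order `≤ 0` -/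

/-- **Order descent along an unramified coordinate system.** If every `k`-derivation of `B` killing all
`x_i` is zero, then a differential operator of finite order which commutes with every multiplication
`x_i·` commutes with every multiplication, i.e. has order `≤ 0`. (Induction on the order: the commutators
`[D, b]` have order `≤ 0` by induction, so `b ↦ [D, b](1)` is a derivation killing the `x_i`.)
[cite: EGAIV4, Cor. 16.11.3 with Prop. 16.8.8 (b) (formally étale / unramified coordinates: Diff is determined on the z_i)] -/
theorem isDiffOpLE_zero_of_commMul_coord_eq_zero {x : ι → B}
    (hunr : ∀ δ : Derivation k B B, (∀ i, δ (x i) = 0) → δ = 0) :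
    ∀ {n : ℕ} {D : B →ₗ[k] B}, IsDiffOpLE k n D → (∀ i, commMul k D (x i) = 0) → IsDiffOpLE k 0 D
  | 0, _, hD, _ => hD
  | n + 1, D, hD, hx => by
    -- every commutator `[D, b]` has order `≤ n` and commutes with the `x i`, hence has order `≤ 0`
    have hE : ∀ b : B, IsDiffOpLE k 0 (commMul k D b) := fun b =>
      isDiffOpLE_zero_of_commMul_coord_eq_zero hunr (hD b) fun i => by
        rw [commMul_comm, hx i, commMul_zero_left]
    have hEb : ∀ b t : B, commMul k D b t = commMul k D b 1 * t := fun b t => by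
      conv_lhs => rw [isDiffOpLE_zero_iff_eq_mulLeft.mp (hE b)]
      rfl
    -- `b ↦ [D, b] 1 = D b − b·D 1` is a `k`-derivation killing the `x i`
    let δ : Derivation k B B :=
      { toFun := fun b => D b - b * D 1
        map_add' := fun a b => by simp only [map_add, add_mul]; ring
        map_smul' := fun r b => by
          simp only [map_smul, smul_mul_assoc, RingHom.id_apply, smul_sub]
        map_one_eq_zero' := by simp
        leibniz' := fun a b => by
          have h := hEb a b
          simp only [commMul_apply, mul_one] at h
          change D (a * b) - a * b * D 1 = a * (D b - b * D 1) + b * (D a - a * D 1)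
          rw [sub_eq_iff_eq_add'.mp h]
          ring }
    have hδ : δ = 0 := hunr δ fun i => by
      have h := hEb (x i) 1
      change D (x i) - x i * D 1 = 0
      have hxi := hx i
      rw [LinearMap.ext_iff] at hxi
      simpa [commMul_apply] using hxi 1
    intro b
    rw [isDiffOpLE_zero_iff_eq_mulLeft.mp (hE b)]
    have hb : commMul k D b 1 = 0 := by
      have := congrArg (fun δ : Derivation k B B => δ b) hδ
      simpa [δ, commMul_apply] using this
    rw [hb, LinearMap.mulLeft_zero_eq_zero]

/-- **Uniqueness on low monomials.** Under (UNR), an operator of order `≤ m` which kills every monomial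
`x^β = ∏ x_i^{β_i}` with `|β| ≤ m` is zero. [cite: EGAIV4, Thm. 16.11.2 (an operator of order ≤ m is determined by its values on the z^q, |q| ≤ m)] -/
theorem eq_zero_of_isDiffOpLE_of_apply_coordMonomial_eq_zero [Fintype ι] [DecidableEq ι] {x : ι → B}
    (hunr : ∀ δ : Derivation k B B, (∀ i, δ (x i) = 0) → δ = 0) :
    ∀ (m : ℕ) {D : B →ₗ[k] B}, IsDiffOpLE k m D →
      (∀ β : ι →₀ ℕ, β.degree ≤ m → D (∏ i, x i ^ β i) = 0) → D = 0
  | 0, D, hD, h0 => by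
    have h1 : D 1 = 0 := by simpa using h0 0 (by simp)
    rw [isDiffOpLE_zero_iff_eq_mulLeft.mp hD, h1]
    exact LinearMap.mulLeft_zero_eq_zero _ _
  | m + 1, D, hD, h0 => by
    have hcomm : ∀ i, commMul k D (x i) = 0 := fun i =>
      eq_zero_of_isDiffOpLE_of_apply_coordMonomial_eq_zero hunr m (hD (x i)) fun β hβ => by
        have hdeg : (Finsupp.single i 1 + β).degree ≤ m + 1 := by
          rw [map_add, Finsupp.degree_single]; omega
        rw [commMul_apply, coord_mul_prod_pow, h0 _ hdeg, h0 β (by omega), mul_zero, sub_zero]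
    have hD0 : IsDiffOpLE k 0 D := isDiffOpLE_zero_of_commMul_coord_eq_zero k hunr hD hcomm
    have h1 : D 1 = 0 := by simpa using h0 0 (by simp)
    rw [isDiffOpLE_zero_iff_eq_mulLeft.mp hD0, h1]
    exact LinearMap.mulLeft_zero_eq_zero _ _

/-! ### Truncated Hasse–Schmidt systems: order, span, Leibniz inclusion -/

variable [DecidableEq ι]

/-- The commutator of a member of a (truncated) Hasse–Schmidt system with a multiplication is a
combination of members of strictly smaller index: `[Δ_q, g] = Σ_{q₁+q₂=q, q₁≠0} Δ_{q₁}(g) · Δ_{q₂}`.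
[cite: EGAIV4, Thm. 16.11.2 ((16.11.2.2), Leibniz for the D_q) with Prop. 16.8.8 (b)] -/
theorem commMul_hasseSystem {Δ : (ι →₀ ℕ) → (B →ₗ[k] B)} (h0 : ∀ b, Δ 0 b = b) {q : ι →₀ ℕ}
    (hmul : ∀ f g : B, Δ q (f * g) = ∑ p ∈ Finset.antidiagonal q, Δ p.1 f * Δ p.2 g) (g : B) :
    commMul k (Δ q) g = ∑ p ∈ (Finset.antidiagonal q).erase (0, q), Δ p.1 g • Δ p.2 := by
  refine LinearMap.ext fun t => ?_
  have hq : ((0 : ι →₀ ℕ), q) ∈ Finset.antidiagonal q := by simp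
  rw [commMul_apply, hmul, ← Finset.add_sum_erase _ _ hq, LinearMap.sum_apply]
  simp only [h0, LinearMap.smul_apply, smul_eq_mul]
  ring

/-- **Members of a truncated Hasse–Schmidt system are differential operators**: `Δ_q` has order `≤ |q|`
(`|q| ≤ n`), by induction on `|q|` through `commMul_hasseSystem`.
[cite: EGAIV4, Thm. 16.11.2 (the D_q, |q| ≤ m, lie in Diff^m)] -/
theorem isDiffOpLE_of_hasseSystem {Δ : (ι →₀ ℕ) → (B →ₗ[k] B)} {n : ℕ} (h0 : ∀ b, Δ 0 b = b)
    (hmul : ∀ q : ι →₀ ℕ, q.degree ≤ n →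
      ∀ f g : B, Δ q (f * g) = ∑ p ∈ Finset.antidiagonal q, Δ p.1 f * Δ p.2 g) :
    ∀ (d : ℕ) (q : ι →₀ ℕ), q.degree ≤ d → d ≤ n → IsDiffOpLE k d (Δ q)
  | 0, q, hq, _ => by
    have : q = 0 := (Finsupp.degree_eq_zero_iff q).1 (Nat.le_zero.1 hq)
    subst this
    have hid : Δ 0 = LinearMap.id := LinearMap.ext h0
    rw [hid]
    exact isDiffOpLE_id
  | d + 1, q, hq, hdn => fun g => by
    rw [commMul_hasseSystem k h0 (hmul q (hq.trans hdn))]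
    refine IsDiffOpLE.sum _ fun p hp => IsDiffOpLE.smul _ (isDiffOpLE_of_hasseSystem h0 hmul d p.2 ?_ (by omega))
    have := degree_snd_lt_of_mem_erase_antidiagonal hp
    omega

omit [DecidableEq ι] in
/-- Exponents of degree exactly `j` (finite coordinate set): the `Finset.finsuppAntidiag`. (plumbing)
[cite: EGAIV4, Thm. 16.11.2 (the index set |q| = m)] -/
theorem mem_finsuppAntidiag_univ_iff' [Fintype ι] [DecidableEq ι] {j : ℕ} {α : ι →₀ ℕ} :
    α ∈ (Finset.univ : Finset ι).finsuppAntidiag j ↔ α.degree = j := by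
  rw [Finset.mem_finsuppAntidiag, Finsupp.degree_eq_sum]
  simp

omit [DecidableEq ι] in
/-- `α ≤ β` and `|α| = |β|` force `α = β` (plumbing). [cite: EGAIV4, Thm. 16.11.2 (index bookkeeping)] -/
theorem eq_of_le_of_degree_eq' {α β : ι →₀ ℕ} (h : α ≤ β) (hd : α.degree = β.degree) : α = β := by
  have hβ : α + (β - α) = β := add_tsub_cancel_of_le h
  have h0 : (β - α).degree = 0 := by
    have := congrArg Finsupp.degree hβ
    rw [map_add, hd] at this
    omega
  rw [Finsupp.degree_eq_zero_iff] at h0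
  rw [← hβ, h0, add_zero]

/-- **Degree peeling** for an abstract Hasse–Schmidt system: for `j ≤ n + 1` there is `E` in the
`B`-span of the `Δ_q`, `|q| ≤ n`, with `(D − E)(x^β) = 0` for all `|β| < j`.
[cite: EGAIV4, Thm. 16.11.2 (proof: D = Σ_{|q| ≤ m} a_q D_q is forced by the values on the z^q)] -/
theorem exists_span_hasseSystem_sub_apply_coordMonomial_eq_zero [Fintype ι] {x : ι → B}
    {Δ : (ι →₀ ℕ) → (B →ₗ[k] B)} {n : ℕ}
    (hself : ∀ β : ι →₀ ℕ, β.degree ≤ n → Δ β (∏ i, x i ^ β i) = 1)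
    (hzero : ∀ q β : ι →₀ ℕ, q.degree ≤ n → ¬ q ≤ β → Δ q (∏ i, x i ^ β i) = 0)
    (D : B →ₗ[k] B) :
    ∀ j : ℕ, j ≤ n + 1 → ∃ E ∈ Submodule.span B {E : B →ₗ[k] B | ∃ q : ι →₀ ℕ, q.degree ≤ n ∧ Δ q = E},
      ∀ β : ι →₀ ℕ, β.degree < j → (D - E) (∏ i, x i ^ β i) = 0
  | 0, _ => ⟨0, Submodule.zero_mem _, fun β hβ => absurd hβ (Nat.not_lt_zero _)⟩
  | j + 1, hj => by
    obtain ⟨E, hE, hkill⟩ := exists_span_hasseSystem_sub_apply_coordMonomial_eq_zero hself hzero D j (by omega)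
    refine ⟨E + ∑ α ∈ (Finset.univ : Finset ι).finsuppAntidiag j, (D - E) (∏ i, x i ^ α i) • Δ α, ?_, ?_⟩
    · refine Submodule.add_mem _ hE (Submodule.sum_mem _ fun α hα => Submodule.smul_mem _ _ ?_)
      exact Submodule.subset_span ⟨α, by rw [mem_finsuppAntidiag_univ_iff'.mp hα]; omega, rfl⟩
    · intro β hβ
      have hsplit : (D - (E + ∑ α ∈ (Finset.univ : Finset ι).finsuppAntidiag j, (D - E) (∏ i, x i ^ α i) • Δ α))
            (∏ i, x i ^ β i) =
          (D - E) (∏ i, x i ^ β i) -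
            ∑ α ∈ (Finset.univ : Finset ι).finsuppAntidiag j, (D - E) (∏ i, x i ^ α i) * Δ α (∏ i, x i ^ β i) := by
        simp only [LinearMap.sub_apply, LinearMap.add_apply, LinearMap.sum_apply, LinearMap.smul_apply,
          smul_eq_mul]
        ring
      rw [hsplit, sub_eq_zero]
      rcases Nat.lt_succ_iff_lt_or_eq.mp hβ with hlt | heq
      · rw [hkill β hlt, eq_comm]
        refine Finset.sum_eq_zero fun α hα => ?_
        rw [hzero α β (by rw [mem_finsuppAntidiag_univ_iff'.mp hα]; omega) ?_, mul_zero]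
        intro hle
        have := Finsupp.degree_mono hle
        rw [mem_finsuppAntidiag_univ_iff'.mp hα] at this
        omega
      · rw [Finset.sum_eq_single β]
        · rw [hself β (by omega), mul_one]
        · intro α hα hne
          rw [hzero α β (by rw [mem_finsuppAntidiag_univ_iff'.mp hα]; omega) ?_, mul_zero]
          intro hle
          exact hne (eq_of_le_of_degree_eq' hle (by rw [mem_finsuppAntidiag_univ_iff'.mp hα, heq]))
        · intro hβ'
          exact absurd (mem_finsuppAntidiag_univ_iff'.mpr heq) hβ'

/-- **EGA IV₄ 16.11.2, spanning half, abstract form.** Under (UNR) and given a truncated Hasse–Schmidt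
system of level `n` along `x`, every differential operator of order `≤ n` lies in the `B`-span of the
`Δ_q`, `|q| ≤ n`. [cite: EGAIV4, Thm. 16.11.2] -/
theorem mem_span_hasseSystem_of_isDiffOpLE [Fintype ι] {x : ι → B} {Δ : (ι →₀ ℕ) → (B →ₗ[k] B)} {n : ℕ}
    (hunr : ∀ δ : Derivation k B B, (∀ i, δ (x i) = 0) → δ = 0)
    (h0 : ∀ b, Δ 0 b = b)
    (hmul : ∀ q : ι →₀ ℕ, q.degree ≤ n →
      ∀ f g : B, Δ q (f * g) = ∑ p ∈ Finset.antidiagonal q, Δ p.1 f * Δ p.2 g)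
    (hself : ∀ β : ι →₀ ℕ, β.degree ≤ n → Δ β (∏ i, x i ^ β i) = 1)
    (hzero : ∀ q β : ι →₀ ℕ, q.degree ≤ n → ¬ q ≤ β → Δ q (∏ i, x i ^ β i) = 0)
    {D : B →ₗ[k] B} (hD : IsDiffOpLE k n D) :
    D ∈ Submodule.span B {E : B →ₗ[k] B | ∃ q : ι →₀ ℕ, q.degree ≤ n ∧ Δ q = E} := by
  obtain ⟨E, hE, hkill⟩ :=
    exists_span_hasseSystem_sub_apply_coordMonomial_eq_zero k hself hzero D (n + 1) le_rfl
  have hEord : IsDiffOpLE k n E := by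
    have hle : Submodule.span B {E : B →ₗ[k] B | ∃ q : ι →₀ ℕ, q.degree ≤ n ∧ Δ q = E} ≤ diffOp k B n := by
      refine Submodule.span_le.2 ?_
      rintro _ ⟨q, hq, rfl⟩
      exact (isDiffOpLE_of_hasseSystem k h0 hmul q.degree q le_rfl hq).of_le hq
    exact hle hE
  have h0' : D - E = 0 :=
    eq_zero_of_isDiffOpLE_of_apply_coordMonomial_eq_zero k hunr n (hD.sub hEord)
      fun β hβ => hkill β (Nat.lt_succ_of_le hβ)
  rw [sub_eq_zero] at h0'
  rw [h0']
  exact hE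

/-- **The Leibniz inclusion in Hasse–Schmidt coordinates**: under (UNR) and a truncated Hasse–Schmidt
system of level `n`, `Diff^{≤ n}(I·J) ⊆ Σ_{i ≤ n} Diff^{≤ i}(I) · Diff^{≤ n−i}(J)` for all ideals `I, J`
of `B` (expand `D = Σ a_q Δ_q` and use the higher Leibniz rule).
[cite: VillamayorU2008ReesDiff, §3 (proof of Thm. 3.4, case 2: Δ^α(a·H) = Σ Δ^{α₁}(a) Δ^{α₂}(H))] -/
theorem diffIdeal_mul_le_of_hasseSystem [Fintype ι] {x : ι → B} {Δ : (ι →₀ ℕ) → (B →ₗ[k] B)} {n : ℕ}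
    (hunr : ∀ δ : Derivation k B B, (∀ i, δ (x i) = 0) → δ = 0)
    (h0 : ∀ b, Δ 0 b = b)
    (hmul : ∀ q : ι →₀ ℕ, q.degree ≤ n →
      ∀ f g : B, Δ q (f * g) = ∑ p ∈ Finset.antidiagonal q, Δ p.1 f * Δ p.2 g)
    (hself : ∀ β : ι →₀ ℕ, β.degree ≤ n → Δ β (∏ i, x i ^ β i) = 1)
    (hzero : ∀ q β : ι →₀ ℕ, q.degree ≤ n → ¬ q ≤ β → Δ q (∏ i, x i ^ β i) = 0)
    (I J : Ideal B) :
    diffIdeal k n (I * J) ≤ ⨆ (i : ℕ) (_ : i ≤ n), diffIdeal k i I * diffIdeal k (n - i) J := by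
  rw [diffIdeal_le_iff]
  intro D hD f hf
  -- reduce to products `a * b`, `a ∈ I`, `b ∈ J`, for every member of the span
  suffices ∀ E ∈ Submodule.span B {E : B →ₗ[k] B | ∃ q : ι →₀ ℕ, q.degree ≤ n ∧ Δ q = E},
      ∀ a ∈ I, ∀ b ∈ J, E (a * b) ∈ ⨆ (i : ℕ) (_ : i ≤ n), diffIdeal k i I * diffIdeal k (n - i) J by
    have hDs := mem_span_hasseSystem_of_isDiffOpLE k hunr h0 hmul hself hzero hD
    refine Submodule.mul_induction_on hf (fun a ha b hb => this D hDs a ha b hb) fun y z hy hz => ?_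
    rw [map_add]; exact add_mem hy hz
  intro E hE
  refine Submodule.span_induction ?_ ?_ ?_ ?_ hE
  · rintro _ ⟨q, hq, rfl⟩ a ha b hb
    rw [hmul q hq]
    refine Ideal.sum_mem _ fun p hp => ?_
    rw [Finset.mem_antidiagonal] at hp
    have hdeg : p.1.degree + p.2.degree = q.degree := by rw [← hp, map_add]
    have h1 : Δ p.1 a ∈ diffIdeal k p.1.degree I :=
      apply_mem_diffIdeal k (isDiffOpLE_of_hasseSystem k h0 hmul _ p.1 le_rfl (by omega)) ha
    have h2 : Δ p.2 b ∈ diffIdeal k (n - p.1.degree) J :=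
      apply_mem_diffIdeal k
        ((isDiffOpLE_of_hasseSystem k h0 hmul _ p.2 le_rfl (by omega)).of_le (by omega)) hb
    have h12 := Ideal.mul_mem_mul h1 h2
    exact (le_iSup₂ (f := fun (i : ℕ) (_ : i ≤ n) => diffIdeal k i I * diffIdeal k (n - i) J)
      p.1.degree (by omega)) h12
  · intro a _ b _; simp
  · intro E E' _ _ hE hE' a ha b hb
    rw [LinearMap.add_apply]; exact add_mem (hE a ha b hb) (hE' a ha b hb)
  · intro c E _ hE a ha b hb
    rw [LinearMap.smul_apply, smul_eq_mul]
    exact Ideal.mul_mem_left _ _ (hE a ha b hb)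

end CoordSpan

end Literature.AlgebraicGeometry.Resolution
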